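import Summits.BirchSwinnertonDyer.BirchSwinnertonDyer.Theorems.ErratumRoadFiveIMCDivRoadFFFittingFrameBOfThm23
import Summits.BirchSwinnertonDyer.BirchSwinnertonDyer.Theorems.ErratumRoadFiveSelfDualMemberCongruenceErratum
import Literature.NumberTheory.EllipticCurves.Castella2018.ErratumThm23UpperDivisibilitySelfDual
import Literature.NumberTheory.EllipticCurves.Castella2018.ErratumHidaMembersFramesWeight
import HarnessLib

/-!
# K2 crux `IMCDivAtErratumDataAllR` (item stmt-BirchSwinnertonDyer-20169), ROAD FF — the deciding stub from the CORRECTED inputs: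
# F4♯† (the erratum's (2.5) on the SELF-DUAL module) + F3♯†-nonsplit (members in the weight progression `2(p−1)p^{m−1} ∣ k_m − 2`)

Cell `bsd-stepL`, seat `bsd-stepL-imc-p1` g24 — TWIST AUDIT of crux `ErratumThm23SigmaLe` (item stmt-BirchSwinnertonDyer-25505), repair
step (R4) part 3 = the CONSUMER (memo `HOME/imc-p1/g24/TWIST-AUDIT-25505-imc-p1-g24.md`); `--supports stmt-BirchSwinnertonDyer-20169 --as helper`;
Theses-free.

## What this file proves and why it exists

A COPY of `Theorems/ErratumRoadFiveIMCDivRoadFFFittingFrameBOfThm23Nonsplit.lean`'s main theorem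
`P2.RoadFF.fittingCongruenceFrameAtErratumDataB_of_thm23_OPEN_of_framesNonsplit (h23 : F4♯) (hL : F3♯-nonsplit)` with BOTH named-fact
hypotheses RE-KEYED to the twist-corrected statements:

* `h23 : Castella2018.erratumThm23_charIdeal_sigma_le_of_isTorsion_selfDual_OPEN` (F4♯†, p658652) — the erratum's Thm. 2.3 «⊂» (2.5) for
  the SELF-DUAL Tate twist `A_g = V_g^†/T_g^†` (§2 p. 2 verbatim), i.e. on `XBig κ (Δ.selfDualCofreeRepOver K) 𝔭bar Σ`; F4♯ stated it on the
  untwisted `Δ.cofreeRepOver K` (`det ε^{k−1}`), which is print's module only at `k = 2`, while every member here has `k_m > 2`;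
* `hL : Castella2018.erratum_exists_frames_members_sigma_congruence_nonsplit_wt` (F3♯†, p659851) — F3♯-nonsplit plus the member weight
  progression `2(p−1)p^{m−1} ∣ k_m − 2`, on which the untwisted congruence (b) IS the self-dual one (`ε^{1−k_m/2} ≡ 1 (mod p^m)`;
  `Theorems.SelfDualTwist.exists_equivariant_equiv_selfDual`).

The CONCLUSION is unchanged (`P2.RoadFF.FittingCongruenceFrameAtErratumDataB W p Σ P_Σ` is a statement about `E` only): the member
modules are internal to the proof. The proof is the original one symbol for symbol, with the member module `(Dm m).Δ.cofreeRepOver K`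
replaced by `(Dm m).Δ.selfDualCofreeRepOver K` throughout — finite generation of `X^Σ_ac(A^†_{g_m})` by [SU14 L.3.1.9] with the self-dual
unramifiedness input `SelfDualTwist.selfDualCofreeRepOver_localMap_inr_apply_eq_self`, the member congruence `e_m` by
`SelfDualTwist.nonempty_memberCongruence_erratum_of_facts_selfDual` (fed the weight clause of F3♯†), and (2.5)_m from F4♯† at the member.
No new mathematics; the K2 `closes` binders `h23`/`hMF` can be re-keyed to 25505† := F4♯† and 23050† := F3♯† with THIS theorem as the glue
in place of `…_of_thm23_OPEN_of_framesNonsplit` (planner ruling).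

HONEST FRAMING: theorems only (no definition, no named fact minted here, no instance, no `sorry`); CONDITIONAL on the two named facts,
one of which (F4♯†, resting on the unrefereed erratum and arXiv:2107.13726 Thm. 4.41) is OPEN; nothing is booked; the anticyclotomic main
conjecture is asserted nowhere; BSD is proved for no pair; no census number moves (T7).

References: [Castella2018Erratum] §2 (p. 2: the self-dual Tate twist), Thm. 1.1 (iii), Thm. 2.3, (2.3)–(2.5), (a)(b)(c), Lemma 2.1,
footnote 1, proof of Thm. 1.1 (pp. 1–4); [FouquetWan2021] Thm. 4.41 (PREPRINT); [Skinner2016PacificMC] §2.6 (2-6-1), §3.1;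
[SkinnerUrban2014] Prop. 3.2.3, Lemma 3.1.9; [Castella2020JIMJ] Thm. 2.11; [Castella2018] Thm. 3.1, (3.1), (4.1); [JetchevSkinnerWan2017] §5.1.
-/

set_option autoImplicit false

noncomputable section

open scoped TensorProduct Classical

open CategoryTheory PowerSeries NumberField IsDedekindDomain Field WeierstrassCurve
open Literature.NumberTheory.GaloisRepresentations Literature.NumberTheory.EllipticCurves
  Literature.NumberTheory.EllipticCurves.BigGaloisRep Literature.NumberTheory.EllipticCurves.GreenbergSelmer
  Literature.NumberTheory.EllipticCurves.Skinner2016 Literature.NumberTheory.EllipticCurves.Rank1Residual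
  Literature.NumberTheory.EllipticCurves.Rank1Residual.Typed Literature.NumberTheory.EllipticCurves.ModularForms
  Literature.NumberTheory.EllipticCurves.Castella2018
open Summit.BirchSwinnertonDyer.Rank1Residual.X11b.Halves Summit.BirchSwinnertonDyer.Rank1Residual.X11b.AcSelmer

namespace Summit.BirchSwinnertonDyer.Rank1Residual.X11b

open RoadFFMember Summit.BirchSwinnertonDyer.BirchSwinnertonDyer.Theorems

/-! ### The deciding stub from F4♯† + F3♯†-nonsplit (self-dual module, weight progression) -/

set_option maxHeartbeats 400000 in
/-- **ROAD FF, THE REGISTERED DECIDING-STUB SIGNATURE of crux `IMCDivAtErratumDataAllR` (item stmt-BirchSwinnertonDyer-20169)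
`∀ W p, P2.RoadFF.FittingCongruenceFrameAtErratumDataB W p Σ(·) P_Σ(·)` from the TWIST-CORRECTED inputs F4♯† (OPEN; (2.5) on the erratum's
self-dual `A_g`) + F3♯†-nonsplit (PUB; members in the weight progression `2(p−1)p^{m−1} ∣ k_m − 2`) — every other input a THEOREM of the
tree.** Same assembly as `…_of_thm23_OPEN_of_framesNonsplit` with the member module `(Dm m).Δ.selfDualCofreeRepOver K` throughout.
CONDITIONAL on `h23` (OPEN) and `hL` (published); closes nothing by itself.
[cite: Castella2018Erratum, §2 (p. 2), Thm. 1.1 (iii), Thm. 2.3 (2.5) and proof of Thm. 1.1 (p. 4)] -/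
theorem P2.RoadFF.fittingCongruenceFrameAtErratumDataB_of_thm23SelfDual_OPEN_of_framesNonsplitWt
    (h23 : erratumThm23_charIdeal_sigma_le_of_isTorsion_selfDual_OPEN)
    (hL : erratum_exists_frames_members_sigma_congruence_nonsplit_wt)
    (W : WeierstrassCurve ℚ) [W.IsElliptic] [W.IsGloballyMinimal] (p : ℕ) [Fact p.Prime] :
    P2.RoadFF.FittingCongruenceFrameAtErratumDataB W p
      (fun K _ _ ↦ (↑(W.sigmaPlacesFinset p K) : Set (HeightOneSpectrum (𝓞 K))))
      (fun K _ _ κ _ ↦ W.sigmaEulerElement p K κ) := by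
  intro _ q _ K _ _ Dt H w₀ P hE hr hqp hmq hns hvq hK hCas hP hc hinf κ hκ γ _ ι' e he 𝔭bar h𝔭bar hne
  show P2.RoadFF.FittingCongruenceFrameTwoSlotAt W p κ (primeOfEmbeddingDatum p ι' w₀.embedding) 𝔭bar γ ι'
    Dt.f (↑(W.sigmaPlacesFinset p K) : Set (HeightOneSpectrum (𝓞 K))) (W.sigmaEulerElement p K κ)
  -- ### the datum's elementary consequences (as in g11's `_of_weak_facts`)
  have hp5 : 5 ≤ p := hE.1
  have hp3 : 3 < p := lt_of_lt_of_le (by norm_num) hp5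
  have hmult : Mult W p := hE.2.1
  have hirr : Irr W p := hE.2.2.1
  have htors : ∀ Q : (W.baseChange ℚ_[p]).toAffine.Point, p • Q = 0 → Q = 0 := hE.2.2.2.2
  have hpN : p ∣ W.conductorNorm ℤ := dvd_conductorNorm_of_mult hmult
  have hsplit2 : ((Ideal.span {(p : ℤ)}).primesOver (𝓞 K)).ncard = 2 :=
    hK.ncard_primesOver_eq_two Fact.out hpN hqp
  have hsp : SplitsIn K p := hK.splitsIn_of_mult hmult (Ne.symm hqp)
  have hHp : SatisfiesHeegnerHypothesis p K := satisfiesHeegnerHypothesis_of_splitsIn Fact.out hsp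
  have hHeeg : ∃ β : ℤ, (4 * (W.conductorNorm ℤ) : ℤ) ∣ β ^ 2 - NumberField.discr K :=
    ⟨H.β, H.dvd_sq_sub⟩
  have hnq : ((Ideal.span {(q : ℤ)}).primesOver (𝓞 K)).ncard ≠ 2 :=
    ncard_primesOver_ne_two_of_dvd_discr hK.1.1 Fact.out hK.2.1
  have key : ∀ (ℓ : ℕ) [Fact ℓ.Prime], Mult W ℓ →
      ((Ideal.span {(ℓ : ℤ)}).primesOver (𝓞 K)).ncard ≠ 2 → ℓ = q := by
    intro ℓ _ hℓ hnsℓ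
    by_contra hne'
    exact hnsℓ (hK.2.2.1 ℓ Fact.out (dvd_conductorNorm_of_mult hℓ) hne')
  -- the erratum's print hypothesis (iii), first half, at this datum: `q` is the only non-`K`-split multiplicative prime, `E` nonsplit at `q`
  have hiii0 : ∀ (ℓ : ℕ) [Fact ℓ.Prime], Mult W ℓ → ((Ideal.span {(ℓ : ℤ)}).primesOver (𝓞 K)).ncard ≠ 2 →
      ¬ W.HasSplitMultiplicativeReductionAtPrime ℓ :=
    erratum_hypothesis_iii_of_forall_eq W K key hns
  have hMpos : 0 < W.conductorNorm ℤ / p := hCas.2.2.2.2.2.1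
  have hpM : ¬ p ∣ W.conductorNorm ℤ / p := hCas.2.2.2.2.2.2.1
  have hq2 : q ≠ 2 := by
    rintro rfl
    have hodd : Odd (NumberField.discr K) := hCas.2.1
    have h2d : (2 : ℤ) ∣ NumberField.discr K := by exact_mod_cast hK.2.1
    exact (Int.not_even_iff_odd.mpr hodd) (even_iff_two_dvd.mpr h2d)
  have hqprime : q.Prime := Fact.out
  have hqN : q ∣ W.conductorNorm ℤ := dvd_conductorNorm_of_mult hmq
  have hqM : q ∣ W.conductorNorm ℤ / p := by
    have hqN' := hqN
    rw [← Nat.div_mul_cancel hpN] at hqN'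
    exact ((Nat.Coprime.dvd_mul_right ((Nat.coprime_primes hqprime Fact.out).2 hqp)).1 hqN')
  have hM : 3 ≤ W.conductorNorm ℤ / p := by
    have hq3 : 3 ≤ q := by
      rcases hqprime.eq_two_or_odd' with h | h
      · exact absurd h hq2
      · have := hqprime.two_le; omega
    exact hq3.trans (Nat.le_of_dvd hMpos hqM)
  haveI : NeZero (W.conductorNorm ℤ / p) := ⟨hMpos.ne'⟩
  -- ### `Σ`
  have hSfin : (↑(W.sigmaPlacesFinset p K) : Set (HeightOneSpectrum (𝓞 K))).Finite :=
    (W.sigmaPlacesFinset p K).finite_toSet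
  have hSp : ∀ w ∈ (↑(W.sigmaPlacesFinset p K) : Set (HeightOneSpectrum (𝓞 K))),
      ((p : ℕ) : 𝓞 K) ∉ w.asIdeal :=
    fun w hw => W.forall_mem_sigmaPlacesFinset_not_mem p K w (Finset.mem_coe.1 hw)
  have hS : ∀ w : HeightOneSpectrum (𝓞 K), w ∉ (↑(W.sigmaPlacesFinset p K) : Set (HeightOneSpectrum (𝓞 K))) →
      ((p : ℕ) : 𝓞 K) ∉ w.asIdeal → (W.baseChange K).HasGoodReductionAt w := by
    intro w hw hwp
    rw [WeierstrassCurve.coe_sigmaPlacesFinset] at hw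
    exact WeierstrassCurve.hasGoodReductionAt_baseChange_of_not_mem_sigmaPlaces hw hwp
  have hSM : ∀ w : HeightOneSpectrum (𝓞 K), w ∉ (↑(W.sigmaPlacesFinset p K) : Set (HeightOneSpectrum (𝓞 K))) →
      ((W.conductorNorm ℤ / p : ℕ) : 𝓞 K) ∉ w.asIdeal := by
    intro w hw hM'
    rw [WeierstrassCurve.coe_sigmaPlacesFinset] at hw
    exact hw (WeierstrassCurve.mem_sigmaPlaces_of_tameLevel_mem hpN hpM hM')
  -- ### `K_{𝔭bar} → ℚ_p` (degree one)
  obtain ⟨heb, hfb⟩ := degreeOne_of_splitsIn hK.1.1 hsp h𝔭bar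
  obtain ⟨φ⟩ := AcSelmer.exists_ringHom_adicCompletion_padic_of_degreeOne p 𝔭bar h𝔭bar heb hfb
  -- ### F3♯†-nonsplit: frames + members (weight progression), receptacle maps `a = unrToCpInt`, `j = toUnr` — hypothesis (iii) discharged by `hiii0`
  obtain ⟨ΩK, Ωp, L, hΩ, hLf, hmem⟩ :=
    hL ι' W K (primeOfEmbeddingDatum p ι' w₀.embedding) κ γ Dt.isNewformOf q rfl hp3 hmult hM hirr hiii0 hmq hnq hvq
      hK.1 hCas.2.1 hHeeg hsplit2 (natCast_mem_primeOfEmbeddingDatum p ι' w₀.embedding)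
      (forall_mem_primeOfEmbeddingDatum_iff p ι' hK.1 w₀) hκ (R1.unrToCpInt p) (toUnr p)
      (R1.coe_unrToCpInt p) (coe_toUnr p)
  choose Dm Qm hDm using fun m : ℕ => hmem (max m 1) (le_max_right m 1)
  -- the inclusions `b_m : 𝒪_m → 𝓞_{ℂ_p}` (characterised) and their coefficient squares
  choose b hb using fun m : ℕ => exists_ringHom_padicCoeffIntegers_padicComplexInt (Dm m).ι
  -- ### topologies and coefficient-ring instances (as in g11)
  letI : TopologicalSpace (IwasawaAlgebra p) := ⊥
  haveI : DiscreteTopology (IwasawaAlgebra p) := ⟨rfl⟩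
  letI τ : ∀ m : ℕ, TopologicalSpace (PowerSeries (padicCoeffIntegers (Dm m).ι)) := fun _ => ⊥
  haveI : ∀ m : ℕ, DiscreteTopology (PowerSeries (padicCoeffIntegers (Dm m).ι)) := fun _ => ⟨rfl⟩
  haveI : ∀ m : ℕ, IsPrincipalIdealRing (padicCoeffIntegers (Dm m).ι) := fun m =>
    (Dm m).isPrincipalIdealRing_coeffRing
  haveI : ∀ m : ℕ, Module.Free ℤ_[p] (padicCoeffIntegers (Dm m).ι) := fun m => (Dm m).moduleFree_coeffRing
  haveI : ∀ m : ℕ, Module.Finite ℤ_[p] (padicCoeffIntegers (Dm m).ι) := fun m =>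
    (Dm m).moduleFinite_coeffRing
  -- finite generation of `X^Σ_ac(A_{g_m})` over `Λ_{𝒪_m}` (SU14 L.3.1.9 is a theorem; T6 + T7 + T8a)
  haveI : ∀ m : ℕ, Module.Finite (PowerSeries (padicCoeffIntegers (Dm m).ι))
      (XBig κ ((Dm m).Δ.selfDualCofreeRepOver K) 𝔭bar (↑(W.sigmaPlacesFinset p K) : Set (HeightOneSpectrum (𝓞 K)))) :=
    fun m =>
      haveI := (Dm m).finiteDimensional_padicCoeffField
      SkinnerUrban2014.moduleFinite_XBig_of_lemma319 SkinnerUrban2014.lemma319_finite_XBig_holds κ 𝔭bar _ hSfin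
        ((Dm m).Δ.selfDualCofreeRepOver K)
        (GreenbergSelmer.Cofree.exists_pow_psmul_eq_zero (Dm m).ι (Dm m).Δ.selfDualRep)
        (GreenbergSelmer.Cofree.divisible (padicCoeffField (Dm m).ι) (Dm m).Δ.selfDualRep (Fact.out : p.Prime).ne_zero)
        (GreenbergSelmer.Cofree.finite_setOf_psmul_eq_zero (Dm m).ι (Dm m).Δ.selfDualRep)
        (SelfDualTwist.selfDualCofreeRepOver_localMap_inr_apply_eq_self (Dm m).Δ K _ hSM)
  -- ### the member congruences `e_m` (F1 + SelBC + Frob + (b) + Lemma 2.1 — all theorems)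
  have hEm : ∀ m : ℕ, 1 ≤ m →
      Nonempty ((((PowerSeries (padicCoeffIntegers (Dm m).ι)) ⊗[IwasawaAlgebra p]
            AcSelmer.XAc (W.baseChange K) p κ 𝔭bar (↑(W.sigmaPlacesFinset p K) : Set (HeightOneSpectrum (𝓞 K))) γ) ⧸
          (((Ideal.span {(C (p : ℤ_[p]) : IwasawaAlgebra p)}).map
              (algebraMap (IwasawaAlgebra p) (PowerSeries (padicCoeffIntegers (Dm m).ι)))) ^ m •
            (⊤ : Submodule (PowerSeries (padicCoeffIntegers (Dm m).ι))
              ((PowerSeries (padicCoeffIntegers (Dm m).ι)) ⊗[IwasawaAlgebra p]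
                AcSelmer.XAc (W.baseChange K) p κ 𝔭bar (↑(W.sigmaPlacesFinset p K) : Set (HeightOneSpectrum (𝓞 K))) γ))))
          ≃ₗ[PowerSeries (padicCoeffIntegers (Dm m).ι)]
        (XBig κ ((Dm m).Δ.selfDualCofreeRepOver K) 𝔭bar (↑(W.sigmaPlacesFinset p K) : Set (HeightOneSpectrum (𝓞 K))) ⧸
          (((Ideal.span {(C (p : ℤ_[p]) : IwasawaAlgebra p)}).map
              (algebraMap (IwasawaAlgebra p) (PowerSeries (padicCoeffIntegers (Dm m).ι)))) ^ m •
            (⊤ : Submodule (PowerSeries (padicCoeffIntegers (Dm m).ι))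
              (XBig κ ((Dm m).Δ.selfDualCofreeRepOver K) 𝔭bar (↑(W.sigmaPlacesFinset p K) : Set (HeightOneSpectrum (𝓞 K)))))))) := by
    intro m hm
    exact nonempty_quotPow_congr_of_eq _ (max_eq_left hm)
      (SelfDualTwist.nonempty_memberCongruence_erratum_of_facts_selfDual SkinnerUrban2014.prop323_XAc_equiv_XBigDecomp_holds
        selmerBig_eq_selmerBigDecomp_of_unramifiedOutside_holds
        Skinner2016.selmerBig_extendScalars_equiv_baseChange_holds hp5 hirr hK.1 hHp 𝔭bar h𝔭bar φ htors _ hSfin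
        hSp hS hSM κ hκ γ (Dm m) (le_max_right m 1) (hDm m).1).some
  -- ### (2.5)_m from F4♯† at the member `g_m` (SELF-DUAL module), receptacle `𝓞_{ℂ_p}⟦T⟧`
  have hCh : ∀ m : ℕ, 1 ≤ m →
      Module.IsTorsion (PowerSeries (padicCoeffIntegers (Dm m).ι))
          (XBig κ ((Dm m).Δ.selfDualCofreeRepOver K) 𝔭bar (↑(W.sigmaPlacesFinset p K) : Set (HeightOneSpectrum (𝓞 K)))) →
        (XBig.charIdeal κ ((Dm m).Δ.selfDualCofreeRepOver K) 𝔭bar (↑(W.sigmaPlacesFinset p K) : Set (HeightOneSpectrum (𝓞 K)))).map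
          (PowerSeries.map (b m)) ≤ Ideal.span {Qm m} := by
    intro m _ hT
    obtain ⟨hkD, hcompD, hirrD, hramD, hStD, hQ, _⟩ := hDm m
    have hk2 : 2 ≤ (Dm m).k := (Dm m).two_lt_k.le
    have hkeven : Even (Dm m).k := by
      obtain ⟨c, hc⟩ := (Dm m).dvd_k_sub_two
      have hp2 : Even ((p : ℤ) - 1) := by
        have hpodd : Odd p := (Fact.out : p.Prime).odd_of_ne_two (by omega)
        obtain ⟨r, hr⟩ := hpodd
        exact ⟨r, by omega⟩
      have : (Dm m).k = ((p : ℤ) - 1) * c + 2 := by omega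
      rw [this]
      exact (hp2.mul_right c).add (by decide)
    have h2 : ((Ideal.span {(2 : ℤ)}).primesOver (𝓞 K)).ncard ≠ 2 →
        (2 ∣ W.conductorNorm ℤ / p ∧ ¬ 4 ∣ W.conductorNorm ℤ / p) := by
      intro h2ns
      have hmult2 : Mult W 2 := by
        by_cases h2N : 2 ∣ W.conductorNorm ℤ
        · by_cases h2q : (2 : ℕ) = q
          · exact absurd h2q.symm hq2
          · exact absurd (hK.2.2.1 2 Nat.prime_two h2N h2q) h2ns
        · exact absurd (hK.2.2.2.1 h2N) h2ns
      haveI : Fact (Nat.Prime 2) := ⟨Nat.prime_two⟩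
      have hfac : (W.conductorNorm ℤ).factorization 2 = 1 :=
        WeierstrassCurve.factorization_conductorNorm_eq_one_of_hasMultiplicativeReductionAtPrime W 2 hmult2
      have hp2 : p ≠ 2 := by omega
      have hN0 : W.conductorNorm ℤ ≠ 0 := by
        intro h0; rw [h0] at hMpos; simp at hMpos
      have hfacM : (W.conductorNorm ℤ / p).factorization 2 = 1 := by
        rw [Nat.factorization_div hpN, Finsupp.coe_tsub, Pi.sub_apply, hfac,
          Nat.Prime.factorization (Fact.out : p.Prime), Finsupp.single_apply, if_neg hp2, Nat.sub_zero]
      refine ⟨?_, fun h4 => ?_⟩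
      · exact (Nat.Prime.dvd_iff_one_le_factorization Nat.prime_two hMpos.ne').mpr (by omega)
      · have := (Nat.Prime.pow_dvd_iff_le_factorization Nat.prime_two hMpos.ne').mp
          (show 2 ^ 2 ∣ W.conductorNorm ℤ / p by simpa using h4)
        omega
    have hiii : ∀ ℓ : ℕ, ℓ.Prime → ℓ ∣ W.conductorNorm ℤ / p →
        ((Ideal.span {(ℓ : ℤ)}).primesOver (𝓞 K)).ncard ≠ 2 →
          ¬ ℓ ^ 2 ∣ W.conductorNorm ℤ / p ∧
            (UpperHalfPlane.qExpansion 1 ⇑(Dm m).g).coeff ℓ = -((ℓ : ℂ) ^ ((Dm m).k / 2 - 1).toNat) := by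
      intro ℓ hℓ hℓM hℓns
      refine ⟨fun hsq => ?_, hStD ℓ hℓ hℓM hℓns⟩
      have hℓN : ℓ ∣ W.conductorNorm ℤ := hℓM.trans (Nat.div_dvd_of_dvd hpN)
      -- `ℓ` non-split and dividing `N` is `q` (Heegner field: every other prime factor splits), and `q ∥ N`
      have hℓq : ℓ = q := by
        by_contra hne'
        exact hℓns (hK.2.2.1 ℓ hℓ hℓN hne')
      subst hℓq
      have hfac : (W.conductorNorm ℤ).factorization ℓ = 1 :=
        WeierstrassCurve.factorization_conductorNorm_eq_one_of_hasMultiplicativeReductionAtPrime W ℓ hmq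
      have h2le := (Nat.Prime.pow_dvd_iff_le_factorization hℓ (by
        intro h0; rw [h0] at hMpos; simp at hMpos)).mp (hsq.trans (Nat.div_dvd_of_dvd hpN))
      omega
    have hHeegM : ∃ β : ℤ, (4 * (W.conductorNorm ℤ / p : ℕ) : ℤ) ∣ β ^ 2 - NumberField.discr K := by
      obtain ⟨β, hβ⟩ := hHeeg
      refine ⟨β, (dvd_trans ?_ hβ)⟩
      exact mul_dvd_mul_left 4 (Int.natCast_dvd_natCast.mpr (Nat.div_dvd_of_dvd hpN))
    have hram' : ∃ v : HeightOneSpectrum (𝓞 ℚ), SkinnerUrban2014.IsResiduallyRamifiedAt (Dm m).Δ v ∧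
        ((Rat.HeightOneSpectrum.primesEquiv v : Nat.Primes) : ℕ) ∣ W.conductorNorm ℤ / p ∧
        ¬ ((Rat.HeightOneSpectrum.primesEquiv v : Nat.Primes) : ℕ) ^ 2 ∣ W.conductorNorm ℤ / p ∧
        ((Ideal.span {(((Rat.HeightOneSpectrum.primesEquiv v : Nat.Primes) : ℕ) : ℤ)}).primesOver (𝓞 K)).ncard
          ≠ 2 := by
      obtain ⟨v, hvq, hvram⟩ := hramD
      refine ⟨v, hvram, ?_, ?_, ?_⟩
      · rw [hvq]; exact hqM
      · rw [hvq]; exact (hiii q hqprime hqM hnq).1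
      · rw [hvq]; exact hnq
    have hSp' : ∀ w ∈ W.sigmaPlacesFinset p K, ((p : ℕ) : 𝓞 K) ∉ w.asIdeal :=
      fun w hw => W.forall_mem_sigmaPlacesFinset_not_mem p K w hw
    have hSM' : ∀ w : HeightOneSpectrum (𝓞 K), ((W.conductorNorm ℤ / p : ℕ) : 𝓞 K) ∈ w.asIdeal →
        w ∈ W.sigmaPlacesFinset p K := by
      intro w hw
      by_contra hw'
      exact hSM w (by rwa [Finset.mem_coe]) hw
    exact h23 ι' (Dm m).g (Dm m).ι (Dm m).Δ K (primeOfEmbeddingDatum p ι' w₀.embedding) 𝔭bar κ γ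
      (W.sigmaPlacesFinset p K) (Dm m).isNewform hk2 hkeven hM hpM hp3 hcompD (Dm m).norm_coeff_p hK.1 hHeegM hsplit2
      (natCast_mem_primeOfEmbeddingDatum p ι' w₀.embedding) (forall_mem_primeOfEmbeddingDatum_iff p ι' hK.1 w₀)
      h𝔭bar hne hirrD hram' h2 hiii hκ hSp' hSM' (b m) (hb m) ΩK
      ⟨R1.unrToCpInt p (Ωp : unrIntegers p), R1.unrToCpInt p ((Ωp⁻¹ : (unrIntegers p)ˣ) : unrIntegers p),
        by rw [← map_mul, Units.mul_inv, map_one], by rw [← map_mul, Units.inv_mul, map_one]⟩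
      (Qm m) hΩ hQ hT
  -- ### (c), one-sided, from F3♯-nonsplit's congruence
  have hc' : ∀ m : ℕ, 1 ≤ m →
      Ideal.span {Qm m} ≤
        Ideal.span {PowerSeries.map (R1.unrToCpInt p) (L * PowerSeries.map (toUnr p) (W.sigmaEulerElement p K κ))} ⊔
          Ideal.span {(PowerSeries.C (((p : ℕ) : 𝓞_ℂ_[p]) ^ m) : PowerSeries 𝓞_ℂ_[p])} := by
    intro m hm
    obtain ⟨_, _, _, _, _, _, hcong⟩ := hDm m
    rw [max_eq_left hm] at hcong
    exact le_sup_left.trans hcong.le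
  -- ### feed the two-slot Fitting congruence frame through the `𝓞_{ℂ_p}` receptacle
  exact P2.RoadFF.fittingCongruenceFrameTwoSlotAt_of_members_descent_le_cpInt_printed hΩ hLf
    (L * PowerSeries.map (toUnr p) (W.sigmaEulerElement p K κ)) (dvd_refl _) hSfin
    (fun m => PowerSeries (padicCoeffIntegers (Dm m).ι))
    (fun m => PowerSeries.map (b m))
    (fun m => map_comp_algebraMap_eq_of_coe_eq (b m) (hb m))
    (fun m => XBig κ ((Dm m).Δ.selfDualCofreeRepOver K) 𝔭bar (↑(W.sigmaPlacesFinset p K) : Set (HeightOneSpectrum (𝓞 K))))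
    Qm (fun m hm => (hEm m hm).some) hCh hc'

/-- **Re-key corollary (one direction is free): F3♯†-nonsplit implies F3♯-nonsplit** (drop the weight conjunct), so any glue still
keyed to `erratum_exists_frames_members_sigma_congruence_nonsplit` can be fed from the stronger re-type. Pure logic; asserts nothing about
either `Prop`. [folklore] [cite: Castella2018Erratum, proof of Thm. 1.1 (a)(b) (p. 4)] -/
theorem erratum_exists_frames_members_sigma_congruence_nonsplit_of_nonsplit_wt
    (hL : erratum_exists_frames_members_sigma_congruence_nonsplit_wt) :
    erratum_exists_frames_members_sigma_congruence_nonsplit := by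
  intro p _ ι W _ _ K _ _ 𝔭 κ γ _ N _ f hf q _ hN hp3 hmult hM hirr hiii hmq hnq hvq hK hodd hHeeg hsplit2 h𝔭 h𝔭w hκ a j
    ha hj
  obtain ⟨ΩK, Ωp, L, hΩ, hLf, hmem⟩ :=
    hL ι W K 𝔭 κ γ hf q hN hp3 hmult hM hirr hiii hmq hnq hvq hK hodd hHeeg hsplit2 h𝔭 h𝔭w hκ a j ha hj
  refine ⟨ΩK, Ωp, L, hΩ, hLf, fun m hm => ?_⟩
  obtain ⟨D, Qm, _, hrest⟩ := hmem m hm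
  exact ⟨D, Qm, hrest⟩

end Summit.BirchSwinnertonDyer.Rank1Residual.X11b

end
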